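import Summits.BirchSwinnertonDyer.BirchSwinnertonDyer.Theorems.EdixhovenFibreFiveSevenStarredOptimalManinUnitFiveSevenTransportedReciprocityOfVariableChange
import Summits.BirchSwinnertonDyer.BirchSwinnertonDyer.Theorems.EdixhovenFibreFiveSevenStarredOptimalManinUnitFiveSevenGoodModelFormula
import Summits.BirchSwinnertonDyer.BirchSwinnertonDyer.Theorems.EdixhovenFibreFiveSevenStarredOptimalManinUnitFiveSevenRecTowerCellsOfLocalFormulaAlt
import Literature.NumberTheory.PAdicHodge.WeilTowerAlternating
import Literature.NumberTheory.PAdicHodge.WeilTowerNondegenerate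
import Literature.NumberTheory.PAdicHodge.LogCyclotomicCupProductNorm
import Literature.NumberTheory.PAdicHodge.KummerFilZeroCoboundaryRationalPointsCells
import HarnessLib

/-!
# Kato's explicit reciprocity FORMULA over the cells' fields of good reduction, potentially SUPERSINGULAR K★ cells — GENERIC NUMEROLOGY
# (part 1 of the proof of the stub `stub_localFormulaSupersingularCells` of skeleton v10; part 2 = `…LocalFormulaSupersingularCells`)
# (route `EdixhovenFibreFiveSeven`, crux K★ stmt-BirchSwinnertonDyer-22226, line `kato-lever`; seat `bsd-line-edix-p1` g30, LEAD)

HONEST FRAMING. Theorems only (no definition, no named fact, no instance, no `sorry`). This file is the generic-numerology core of the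
proof of ONE registered stub of skeleton v10 (`Lines/kato_lever.lean`, closed by name in `…LocalFormulaSupersingularCells`); the crux K★ stays OPEN ⟸ {P1-bar, DD, `stub_localFormulaOrdinaryCells`}; BSD is not proved by any of this.

WHAT. For a globally minimal `W/ℚ` IN a potentially supersingular cell, ANY number field `K ∋ α` with `α^e = p` (`e` from the cell table), ANY place
`v′ ∋ p` (packet keys), ANY compatible `ω′`, the Weil tower of `W` with SEVEN laws (levelwise alternation `halt` included — skeleton v10) and the
Prop-1.2.3 binders of the direct representation handed over: for every line datum `d″` SOME `c′` with
`⟨[η″], P′⟩ = Tr_{K_{v′}/ℚ_p}(c′ · exp*_{d″}(η″) · log_{ω′} P′)`. ASSEMBLY of the line's (K₂)^ram road: edix-p4 g28's E6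
`…TransportedReciprocityOfVariableChange.exists_const_tatePairingPoint_eq_trace_mul_padicLog_of_variableChange` (T5-A…F, E3–E5 inside) fed with the
PER-CELL MODEL DATA (as in `…GoodModelFormula`: `D = (X^e − p, α)`, `ψ`, `W_D`, `IsUnit Δ`, Hasse, `E₀`, `hWE`, `p ∤ Δ(E₀)`, Hasse(`E₀`), (N1′), `N = e`),
the change of variables `C = (α^k/6; …) ⊗ K_{v′}` with `C • (W ⊗ K_{v′}) = E` and `|u| = |α|^k ≤ 1` (`|6| = 1` by Bézout at `p ∈ {5, 7}`), the `ℤ_p`-valued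
`log χ` (`exists_continuousMap_coe_eq_logCyclotomic`), and `heL` / `healt` / `henondeg` from `halt` / `hnondeg` (`PAdicHodge.WeilTowerAlternating/Nondegenerate`).

* `exists_variableChange_eq_short_u` — `EisensteinRootShortModel.exists_variableChange_eq_short` remembering `C.u = u`;
* ★★★ `localFormula_of_numerology` — generic numerology;
(the registered stub, by the cell table, is in the sequel file).

References: [Kato1993LNM1553] Ch. II Thm. 1.4.1 (3)–(4), Lemma 1.4.3–1.4.5, §1.2.4; [BlochKato1990] Prop. 3.8, Ex. 3.10.1, Example 3.11; [SilvermanAEC2009]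
III.1, Prop. III.8.1, VII.5.5, IV.7.5, Thm. IV.6.4; [SilvermanATAEC1994] IV Table 4.1; [Fontaine1982FormesDifferentielles] §5.
-/

set_option autoImplicit false
-- single-conjunct summit: `Summit.BirchSwinnertonDyer.BirchSwinnertonDyer.…` repeats the name by design
set_option linter.dupNamespace false

noncomputable section

open Field Function ValuativeRel WittVector NumberField IsDedekindDomain Polynomial
open scoped NumberField Topology Classical NNReal
open Literature.NumberTheory.PAdicHodge Literature.NumberTheory.GaloisRepresentations
  Literature.NumberTheory.GaloisRepresentations.IsNonarchimedeanLocalField Literature.NumberTheory.GaloisRepresentations.LubinTate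
  Literature.NumberTheory.GaloisCohomology Literature.NumberTheory.EllipticCurves Literature.NumberTheory.EllipticCurves.FormalGroupChart
  Literature.NumberTheory.PAdicHodge.GaloisContinuity Literature.IUT.LogVolume Literature.RingTheory.FormalGroups
  Literature.AlgebraicGeometry.Resolution _root_.WeierstrassCurve
  Literature.NumberTheory.EllipticCurves.Rank1Residual Literature.NumberTheory.DiophantineGeometry Rat.HeightOneSpectrum
  Summit.BirchSwinnertonDyer.Rank1Residual Summit.BirchSwinnertonDyer.Rank1Residual.Additive
  Summit.BirchSwinnertonDyer.BirchSwinnertonDyer.Theorems.StarredOptimalManinUnitFiveSevenSupersingularCellsModels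
  Summit.BirchSwinnertonDyer.BirchSwinnertonDyer.Theorems.KimAtThreeDeepLowerExpStarOmega

namespace Summit.BirchSwinnertonDyer.BirchSwinnertonDyer.Theorems.StarredOptimalManinUnitFiveSevenLocalFormulaSupersingularCellsNumerology

/-- **Short Weierstrass model by a change of variables with PRESCRIBED `u`** (`EisensteinRootShortModel.exists_variableChange_eq_short`, remembering
`C.u = u`: `C = (u, 0, 0, 0) · toShortNF`, and `toShortNF` has `u = 1`). [cite: SilvermanAEC2009, III.1 (p. 42–45)] -/
theorem exists_variableChange_eq_short_u {L : Type*} [Field L] (h2 : (2 : L) ≠ 0) (h3 : (3 : L) ≠ 0) (W : WeierstrassCurve L)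
    {u : L} (hu : u ≠ 0) :
    ∃ C : WeierstrassCurve.VariableChange L, (C.u : L) = u ∧ C • W = ⟨0, 0, 0, -W.c₄ / (48 * u ^ 4), -W.c₆ / (864 * u ^ 6)⟩ := by
  letI : Invertible (2 : L) := invertibleOfNonzero h2
  letI : Invertible (3 : L) := invertibleOfNonzero h3
  set S := W.toShortNF • W with hS
  haveI : S.IsShortNF := W.toShortNF_spec
  have hc4 : S.c₄ = W.c₄ := by rw [hS, WeierstrassCurve.variableChange_c₄]; simp [WeierstrassCurve.toShortNF,
    WeierstrassCurve.toCharNeTwoNF, WeierstrassCurve.VariableChange.mul_def]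
  have hc6 : S.c₆ = W.c₆ := by rw [hS, WeierstrassCurve.variableChange_c₆]; simp [WeierstrassCurve.toShortNF,
    WeierstrassCurve.toCharNeTwoNF, WeierstrassCurve.VariableChange.mul_def]
  have h48 : (48 : L) ≠ 0 := by
    have : (48 : L) = 2 ^ 4 * 3 := by norm_num
    rw [this]; exact mul_ne_zero (pow_ne_zero _ h2) h3
  have h864 : (864 : L) ≠ 0 := by
    have : (864 : L) = 2 ^ 5 * 3 ^ 3 := by norm_num
    rw [this]; exact mul_ne_zero (pow_ne_zero _ h2) (pow_ne_zero _ h3)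
  have ha4 : S.a₄ = -W.c₄ / 48 := by
    rw [← hc4, S.c₄_of_isShortNF]; field_simp
  have ha6 : S.a₆ = -W.c₆ / 864 := by
    rw [← hc6, S.c₆_of_isShortNF]; field_simp
  refine ⟨⟨Units.mk0 u hu, 0, 0, 0⟩ * W.toShortNF, ?_, ?_⟩
  · simp [WeierstrassCurve.VariableChange.mul_def, WeierstrassCurve.toShortNF, WeierstrassCurve.toCharNeTwoNF]
  rw [mul_smul, ← hS]
  ext
  · simp [WeierstrassCurve.variableChange_a₁]
  · simp [WeierstrassCurve.variableChange_a₂]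
  · simp [WeierstrassCurve.variableChange_a₃]
  · simp only [WeierstrassCurve.variableChange_a₄, S.a₁_of_isShortNF, S.a₂_of_isShortNF, S.a₃_of_isShortNF, ha4]
    simp
    field_simp
  · simp only [WeierstrassCurve.variableChange_a₆, S.a₁_of_isShortNF, S.a₂_of_isShortNF, S.a₃_of_isShortNF, ha6]
    simp
    field_simp

variable (W : WeierstrassCurve ℚ) [W.IsElliptic] [W.IsGloballyMinimal] (p : ℕ) [hp : Fact p.Prime]

set_option maxHeartbeats 1600000 in
/-- ★★★ **Kato's explicit reciprocity formula for the DIRECT representation of a supersingular-cell curve over `K_{v′}`, generic numerology**: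
E6 `…TransportedReciprocityOfVariableChange.exists_const_tatePairingPoint_eq_trace_mul_padicLog_of_variableChange` with the per-cell model data, the
change of variables `C = (α^k/6; …)` (`|u| ≤ 1`), the `ℤ_p`-valued `log χ`, and `heL`/`healt`/`henondeg` (from `halt`, `hnondeg`) discharged.
[cite: Kato1993LNM1553, Ch. II Thm. 1.4.1 (3)–(4), Lemma 1.4.3] [cite: SilvermanAEC2009, III.1, Prop. III.8.1, VII.5.5 and IV.7.5] [cite: Fontaine1982FormesDifferentielles, §5] -/
theorem localFormula_of_numerology (hp57 : p = 5 ∨ p = 7) (hj : 0 ≤ padicValRat p W.j)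
    {e k m n r₄ r₆ t₄ t₆ : ℕ} (he : 0 < e) (hem : e * m = 4 * k + r₄) (hen : e * n = 6 * k + r₆)
    (h₄ : 3 * r₄ = e * t₄) (h₆ : 2 * r₆ = e * t₆)
    (hm : 3 * m = padicValInt p W.minimalDiscriminantInt + t₄) (hn : 2 * n = padicValInt p W.minimalDiscriminantInt + t₆)
    (ht₄ : t₄ ≤ 2) (ht₆ : t₆ ≤ 1) (h5 : p = 5 → 0 < r₄ ∧ e < 9 ∧ e < r₄ + 4) (h7 : p = 7 → 0 < r₆ ∧ e < 13 ∧ e < r₆ + 6)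
    (h50 : p = 5 → r₆ = 0) (h70 : p = 7 → r₄ = 0)
    {K : Type} [Field K] [NumberField K] {α : K} (hαe : α ^ e = (p : K))
    (v' : HeightOneSpectrum (𝓞 K)) (hv' : ((p : ℕ) : 𝓞 K) ∈ v'.asIdeal)
    [CharZero (v'.adicCompletion K)] [Fact (¬ IsUnit ((p : ℕ) : integerC (v'.adicCompletion K)))]
    [IsAdicComplete (Ideal.span {((p : ℕ) : integerC (v'.adicCompletion K))}) (integerC (v'.adicCompletion K))]
    (hp' : valuation (v'.adicCompletion K) ((p : ℕ) : (v'.adicCompletion K)) < 1)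
    (ω' : Valuation (v'.adicCompletion K) ℝ≥0) [ω'.Compatible] [(W.baseChange (v'.adicCompletion K)).IsIntegral ω'.integer] :
    letI := LocalField.adicCompletionPadicAlgebra v' p hv'
    ∀ (eT : (k : ℕ) → geomTorsion W ((p ^ k : ℕ) : ℤ) → geomTorsion W ((p ^ k : ℕ) : ℤ) → AlgebraicClosure ℚ) (hμ : ∀ k S T, eT k S T ^ (p ^ k) = 1)
      (hadd₁ : ∀ k S₁ S₂ T, eT k (S₁ + S₂) T = eT k S₁ T * eT k S₂ T) (hadd₂ : ∀ k S T₁ T₂, eT k S (T₁ + T₂) = eT k S T₁ * eT k S T₂)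
      (hgal : ∀ k (σ : absoluteGaloisGroup ℚ) (S T : geomTorsion W ((p ^ k : ℕ) : ℤ)), σ • eT k S T = eT k (σ • S) (σ • T))
      (_hnondeg : ∀ k (T : geomTorsion W ((p ^ k : ℕ) : ℤ)), (∀ S, eT k S T = 1) → T = 0) (_halt : ∀ k (S : geomTorsion W ((p ^ k : ℕ) : ℤ)), eT k S S = 1)
      (hcompat : ∀ k (S T : geomTorsion W ((p ^ (k + 1) : ℕ) : ℤ)),
      eT k (torsionMulHom W (p ^ (k + 1)) (p ^ k) p (pow_succ p k).symm S) (torsionMulHom W (p ^ (k + 1)) (p ^ k) p (pow_succ p k).symm T) = eT (k + 1) S T ^ p),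
      (bdRPeriodRingData (F := (v'.adicCompletion K)) (p := p) hp').CupLogInjective (logCyclotomic p) (restrictedRationalTateRep W (v'.adicCompletion K) p) →
      (∀ z : contOneCocycles (restrictedRationalTateRep W (v'.adicCompletion K) p).toTopRep,
        (bdRPeriodRingData (F := (v'.adicCompletion K)) (p := p) hp').HasDualExp (logCyclotomic p) (restrictedRationalTateRep W (v'.adicCompletion K) p) fun σ => z.1 σ) →
      ∀ d'' : (bdRPeriodRingData (F := (v'.adicCompletion K)) (p := p) hp').FilZeroLine (restrictedRationalTateRep W (v'.adicCompletion K) p), ∃ c' : (v'.adicCompletion K),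
      ∀ (η'' : contOneCocycles (restrictedTateRep W (v'.adicCompletion K) p).toTopRep) (P' : (W.baseChange (v'.adicCompletion K)).toAffine.Point),
      ((tatePairingPoint W (v'.adicCompletion K) p eT hμ hadd₁ hadd₂ hgal hcompat (oneCocycleClass _ η'') P' : ℤ_[p]) : ℚ_[p]) =
        Algebra.trace ℚ_[p] (v'.adicCompletion K) (c' * expStarCoord W hp' d'' η'' * padicLogPointFiniteExt ω' (W.baseChange (v'.adicCompletion K)) p P') := by
  intro eT hμ hadd₁ hadd₂ hgal hnondeg halt hcompat hinjK hdeK d''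
  letI := LocalField.adicCompletionPadicAlgebra v' p hv'
  haveI : CharZero (CompletedAlgClosure (v'.adicCompletion K)) := charZero_of_injective_algebraMap (algebraMap (v'.adicCompletion K) (CompletedAlgClosure (v'.adicCompletion K))).injective
  have hpr : p.Prime := hp.out
  have hp5 : 5 ≤ p := by rcases hp57 with rfl | rfl <;> norm_num
  have hp2 : p ≠ 2 := by omega
  have hr₄ : p = 5 → 0 < r₄ := fun h => (h5 h).1
  have hr₆ : p = 7 → 0 < r₆ := fun h => (h7 h).1
  -- §1 the cell numerology (verbatim from `…SupersingularCellsModels.isDeRham_adicCompletion_rat_of_model_of_ramifiedCapstone`)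
  set V := integralModelInt W with hV
  set vΔ := padicValInt p W.minimalDiscriminantInt with hvΔ
  obtain ⟨A, hA⟩ := pow_dvd_c₄_of_padicValRat_j_nonneg W p hj (m := m) (by omega)
  obtain ⟨B, hB⟩ := pow_dvd_c₆_of_padicValRat_j_nonneg W p hj (n := n) (by omega)
  have hΔ0 : V.Δ ≠ 0 := minimalDiscriminantInt_ne_zero W
  obtain ⟨dd, hd⟩ : (p : ℤ) ^ vΔ ∣ V.Δ := (padicValInt_dvd_iff _ _).2 (Or.inr le_rfl)
  have hpd : ¬ (p : ℤ) ∣ dd := by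
    rintro ⟨d', rfl⟩
    have : (p : ℤ) ^ (vΔ + 1) ∣ V.Δ := ⟨d', by rw [hd, pow_succ]; ring⟩
    rcases (padicValInt_dvd_iff _ _).1 this with h | h
    · exact hΔ0 h
    · have h' : vΔ + 1 ≤ vΔ := h
      omega
  -- the unit `64a³p^{t₄} + 432b²p^{t₆}` with `(a, b) = (−27A, −54B)`, as an integer and in `ℤ_p`
  have hid := unit_identity (q := (p : ℤ)) (by exact_mod_cast hpr.ne_zero) hA.symm hB.symm hd.symm V.c_relation hm hn
  have hz : ¬ (p : ℤ) ∣ -(6 ^ 12 * dd) := by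
    rw [dvd_neg]
    intro h
    rcases (Nat.prime_iff_prime_int.mp hpr).dvd_or_dvd h with h6 | h6
    · have hp6 : (p : ℤ) ∣ 6 := Int.Prime.dvd_pow' hpr h6
      rcases hp57 with rfl | rfl <;> norm_num at hp6
    · exact hpd h6
  have hU : ¬ (p : ℤ) ∣ 64 * (-27 * A) ^ 3 * (p : ℤ) ^ t₄ + 432 * (-54 * B) ^ 2 * (p : ℤ) ^ t₆ := by rwa [hid]
  have hunit : IsUnit (64 * (-27 * (A : ℤ_[p])) ^ 3 * (p : ℤ_[p]) ^ t₄ + 432 * (-54 * (B : ℤ_[p])) ^ 2 * (p : ℤ_[p]) ^ t₆) := by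
    have hu : IsUnit (((-(6 ^ 12 * dd) : ℤ)) : ℤ_[p]) := by
      rw [PadicInt.isUnit_iff]
      exact le_antisymm (PadicInt.norm_le_one _) (not_lt.1 fun h => hz ((PadicInt.norm_int_lt_one_iff_dvd _).1 h))
    rw [← hid] at hu
    push_cast at hu
    exact hu
  have hunit' : IsUnit (64 * (((-27 * A : ℤ) : ℤ_[p])) ^ 3 * (p : ℤ_[p]) ^ t₄ + 432 * (((-54 * B : ℤ) : ℤ_[p])) ^ 2 * (p : ℤ_[p]) ^ t₆) := by
    push_cast
    exact hunit
  have hα0 : α ≠ 0 := by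
    intro h0; rw [h0, zero_pow he.ne'] at hαe; exact (Nat.cast_ne_zero.2 hpr.ne_zero) hαe.symm
  -- §2 the `K`-model `S ≅ W ×_ℚ K`
  set S : WeierstrassCurve K := ⟨0, 0, 0, -27 * (V.c₄ : K) / (α ^ k) ^ 4, -54 * (V.c₆ : K) / (α ^ k) ^ 6⟩ with hS
  have hWK : W.baseChange K = V.map (Int.castRingHom K) := by
    rw [WeierstrassCurve.baseChange, ← map_integralModelInt W, WeierstrassCurve.map_map]
    congr 1
    exact RingHom.ext_int _ _
  have hc4K : (W.baseChange K).c₄ = (V.c₄ : K) := by rw [hWK, WeierstrassCurve.map_c₄, eq_intCast]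
  have hc6K : (W.baseChange K).c₆ = (V.c₆ : K) := by rw [hWK, WeierstrassCurve.map_c₆, eq_intCast]
  have h6 : (6 : K) ≠ 0 := by norm_num
  obtain ⟨C, hCu, hC⟩ := exists_variableChange_eq_short_u (L := K) two_ne_zero three_ne_zero (W.baseChange K)
    (u := α ^ k / 6) (div_ne_zero (pow_ne_zero _ hα0) h6)
  have e4 : -(V.c₄ : K) / (48 * (α ^ k / 6) ^ 4) = -27 * (V.c₄ : K) / (α ^ k) ^ 4 := by
    have : (α ^ k) ≠ 0 := pow_ne_zero _ hα0
    field_simp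
    ring
  have e6 : -(V.c₆ : K) / (864 * (α ^ k / 6) ^ 6) = -54 * (V.c₆ : K) / (α ^ k) ^ 6 := by
    have : (α ^ k) ≠ 0 := pow_ne_zero _ hα0
    field_simp
    ring
  have hC' : C • W.baseChange K = S := by rw [hC, hS, hc4K, hc6K, e4, e6]
  -- §3 over `F = K_{v′}`: `ϖ = α`, `D = (X^e − p, ϖ)`, `ψ : 𝒪_D → 𝒪_F`, the good model `W_D`
  obtain ⟨ϖ, hϖ⟩ : ∃ ϖ : v'.adicCompletion K, ϖ = algebraMap K (v'.adicCompletion K) α := ⟨_, rfl⟩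
  have hϖe : ϖ ^ e = (p : v'.adicCompletion K) := by rw [hϖ, ← map_pow, hαe, map_natCast]
  have hϖ0 : ϖ ≠ 0 := by rw [hϖ]; exact (_root_.map_ne_zero _).2 hα0
  obtain ⟨D, hD, hDroot⟩ := EisensteinRoot.exists_poly_eq_X_pow_sub_C hp' he hϖe
  have hroot := D.root_pow_eq_of_poly_eq hD
  obtain ⟨ψ₀, hψ₀⟩ : ∃ ψ₀ : EisensteinRoot.CoeffDisc D →+* LTCoeff (v'.adicCompletion K),
      ∀ c, algebraMap (LTCoeff (v'.adicCompletion K)) (v'.adicCompletion K) (ψ₀ c) = EisensteinRoot.CoeffDisc.toF D c := by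
    obtain ⟨β, hβ⟩ := EisensteinRoot.exists_coeffToLTCoeff D
    exact ⟨β.comp (EisensteinRoot.CoeffDisc.of D).symm.toRingHom, fun c => hβ _⟩
  haveI : CharP 𝓀[v'.adicCompletion K] p := charP_residueField_of_valuation_lt_one hp'
  -- the model over `𝒪_D` (both presentations) and its reduction data
  set WD : WeierstrassCurve D.Coeff := ⟨0, 0, 0, AdjoinRoot.of D.poly ((-27 * A : ℤ) : ℤ_[p]) * AdjoinRoot.root D.poly ^ r₄,
      AdjoinRoot.of D.poly ((-54 * B : ℤ) : ℤ_[p]) * AdjoinRoot.root D.poly ^ r₆⟩ with hWD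
  set Wm : WeierstrassCurve (EisensteinRoot.CoeffDisc D) := WD.map (EisensteinRoot.CoeffDisc.of D).toRingHom with hWm
  have hWmψ : Wm.map ψ₀ = WD.map (ψ₀.comp (EisensteinRoot.CoeffDisc.of D).toRingHom) := by rw [hWm, WeierstrassCurve.map_map]
  have hΔ : IsUnit (Wm.map ψ₀).Δ := by
    rw [hWmψ]; exact AinfTop.isUnit_Δ_map_model (F := v'.adicCompletion K) hD (ψ₀.comp (EisensteinRoot.CoeffDisc.of D).toRingHom) _ _ h₄ h₆ hunit'
  have hHasse : ((Wm.map ψ₀).map (AinfTop.redCoeff (v'.adicCompletion K))).hasseCoeff p = 0 := by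
    rw [hWmψ]; exact AinfTop.hasseCoeff_red_map_model_eq_zero hD (ψ₀.comp (EisensteinRoot.CoeffDisc.of D).toRingHom) _ _ hp57 hr₄ hr₆
  haveI hEll : (AinfTop.curveFO (v'.adicCompletion K) (Wm.map ψ₀)).IsElliptic := AinfTop.isElliptic_curveFO _ hΔ
  haveI hEllC : (curveOver (CompletedAlgClosure (v'.adicCompletion K)) (Wm.map ψ₀)).IsElliptic := AinfTop.isElliptic_curveOverC_O hΔ
  -- `E := (W_D ⊗_ψ 𝒪_F) ⊗ F = W_D ⊗_{𝒪_D} F = S ⊗ F = (C ⊗ F) • (W ⊗ F)`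
  have hEWD : AinfTop.curveFO (v'.adicCompletion K) (Wm.map ψ₀) = WD.map (EisensteinRoot.Coeff.toF D) := by
    rw [hWm]; exact AinfRamTop.curveFO_map_of_map_ψ WD ψ₀ hψ₀
  have hSF : S.baseChange (v'.adicCompletion K) = WD.map (EisensteinRoot.Coeff.toF D) := by
    rw [hWD, map_model_toF, hDroot]
    have hp4 : (ϖ ^ k) ^ 4 * ϖ ^ r₄ = (p : v'.adicCompletion K) ^ m := by
      rw [← pow_mul, ← pow_add, show k * 4 + r₄ = e * m by omega, pow_mul, hϖe]
    have hp6 : (ϖ ^ k) ^ 6 * ϖ ^ r₆ = (p : v'.adicCompletion K) ^ n := by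
      rw [← pow_mul, ← pow_add, show k * 6 + r₆ = e * n by omega, pow_mul, hϖe]
    have hc4F : ((V.c₄ : ℤ) : v'.adicCompletion K) = (ϖ ^ k) ^ 4 * ϖ ^ r₄ * (A : v'.adicCompletion K) := by
      rw [hp4, hA]; push_cast; ring
    have hc6F : ((V.c₆ : ℤ) : v'.adicCompletion K) = (ϖ ^ k) ^ 6 * ϖ ^ r₆ * (B : v'.adicCompletion K) := by
      rw [hp6, hB]; push_cast; ring
    have hϖk : ϖ ^ k ≠ 0 := pow_ne_zero _ hϖ0
    have ha4 : algebraMap K (v'.adicCompletion K) (-27 * (V.c₄ : K) / (α ^ k) ^ 4) =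
        zpToF hp' ((-27 * A : ℤ) : ℤ_[p]) * ϖ ^ r₄ := by
      rw [map_div₀, map_mul, map_neg, map_ofNat, map_intCast, map_pow, map_pow, ← hϖ, map_intCast, hc4F]
      field_simp
      push_cast
      ring
    have ha6 : algebraMap K (v'.adicCompletion K) (-54 * (V.c₆ : K) / (α ^ k) ^ 6) =
        zpToF hp' ((-54 * B : ℤ) : ℤ_[p]) * ϖ ^ r₆ := by
      rw [map_div₀, map_mul, map_neg, map_ofNat, map_intCast, map_pow, map_pow, ← hϖ, map_intCast, hc6F]
      field_simp
      push_cast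
      ring
    exact WeierstrassCurve.ext (map_zero _) (map_zero _) (map_zero _) ha4 ha6
  have hWKF : (W.baseChange K).baseChange (v'.adicCompletion K) = W.baseChange (v'.adicCompletion K) :=
    (W.map_baseChange (IsScalarTower.toAlgHom ℚ K (v'.adicCompletion K)))
  have hCE : (C.map (algebraMap K (v'.adicCompletion K))) • W.baseChange (v'.adicCompletion K) =
      AinfTop.curveFO (v'.adicCompletion K) (Wm.map ψ₀) := by
    rw [hEWD, ← hSF, ← hC', ← hWKF]
    simp only [WeierstrassCurve.baseChange, WeierstrassCurve.map_variableChange]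
  -- §4 the CM fibre `E₀` and its data
  set a : ℤ := -27 * A with ha
  set b : ℤ := -54 * B with hb
  set E₀ : WeierstrassCurve ℤ := ⟨0, 0, 0, if r₄ = 0 then a else 0, if r₆ = 0 then b else 0⟩ with hE₀
  have hWmE : Wm = ⟨0, 0, 0, algebraMap ℤ (EisensteinRoot.CoeffDisc D) a * EisensteinRoot.CoeffDisc.of D (AdjoinRoot.root D.poly) ^ r₄,
      algebraMap ℤ (EisensteinRoot.CoeffDisc D) b * EisensteinRoot.CoeffDisc.of D (AdjoinRoot.root D.poly) ^ r₆⟩ := by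
    rw [hWm, hWD]
    refine WeierstrassCurve.ext (map_zero _) (map_zero _) (map_zero _) ?_ ?_ <;>
    · simp only [WeierstrassCurve.map, RingEquiv.toRingHom_eq_coe, RingHom.coe_coe, map_mul, map_pow, map_intCast, eq_intCast]
  have hWE : Wm.map (Ideal.Quotient.mk (Ideal.span {EisensteinRoot.CoeffDisc.of D (AdjoinRoot.root D.poly)})) =
      (E₀.map (algebraMap ℤ (EisensteinRoot.CoeffDisc D))).map
        (Ideal.Quotient.mk (Ideal.span {EisensteinRoot.CoeffDisc.of D (AdjoinRoot.root D.poly)})) := by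
    rw [hWmE, hE₀]; exact map_explicitModel_eq_map_cmFibre D a b r₄ r₆
  -- `p ∤ Δ(E₀)` and Hasse(E₀) = 0, by cases on the cell prime
  have hE₀Δ : ¬ (p : ℤ) ∣ E₀.Δ ∧ (E₀.map (Int.castRingHom (ZMod p))).hasseCoeff p = 0 := by
    have hmap : E₀.map (Int.castRingHom (ZMod p)) =
        ⟨0, 0, 0, ((if r₄ = 0 then a else 0 : ℤ) : ZMod p), ((if r₆ = 0 then b else 0 : ℤ) : ZMod p)⟩ := by
      rw [hE₀]; simp only [WeierstrassCurve.map, map_zero, eq_intCast]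
    rcases hp57 with rfl | rfl
    · -- `p = 5`: `r₄ > 0`, `r₆ = 0`, `t₆ = 0`, `t₄ > 0`; `E₀ = y² = x³ + b`, `Δ(E₀) = −432 b²`, Hasse `= 32·0`
      have hr4 : r₄ ≠ 0 := (hr₄ rfl).ne'
      have hr6 : r₆ = 0 := h50 rfl
      have ht6 : t₆ = 0 := by
        rcases Nat.eq_zero_or_pos t₆ with h | h
        · exact h
        · exfalso; have := Nat.mul_pos he h; omega
      have ht4 : t₄ ≠ 0 := by
        intro h; rw [h, mul_zero] at h₄; omega
      have hX : ((5 : ℕ) : ℤ) ∣ 64 * (-27 * A) ^ 3 * ((5 : ℕ) : ℤ) ^ t₄ := Dvd.dvd.mul_left (dvd_pow_self _ ht4) _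
      have hY : ¬ ((5 : ℕ) : ℤ) ∣ 432 * (-54 * B) ^ 2 := by
        intro hY; apply hU; rw [ht6, pow_zero, mul_one]; exact dvd_add hX hY
      refine ⟨?_, ?_⟩
      · have hΔE : E₀.Δ = -(432 * (-54 * B) ^ 2) := by
          rw [hE₀]
          simp only [if_neg hr4, if_pos hr6, hb, WeierstrassCurve.Δ, WeierstrassCurve.b₂, WeierstrassCurve.b₄, WeierstrassCurve.b₆,
            WeierstrassCurve.b₈]
          ring
        rw [hΔE, dvd_neg]; exact hY
      · rw [hmap, hasseCoeff_five_short, if_neg hr4, Int.cast_zero, mul_zero]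
    · -- `p = 7`: `r₄ = 0`, `r₆ > 0`, `t₄ = 0`, `t₆ > 0`; `E₀ = y² = x³ + a x`, `Δ(E₀) = −64 a³`, Hasse `= 192·0`
      have hr6 : r₆ ≠ 0 := (hr₆ rfl).ne'
      have hr4 : r₄ = 0 := h70 rfl
      have ht4 : t₄ = 0 := by
        rcases Nat.eq_zero_or_pos t₄ with h | h
        · exact h
        · exfalso; have := Nat.mul_pos he h; omega
      have ht6 : t₆ ≠ 0 := by
        intro h; rw [h, mul_zero] at h₆; omega
      have hX : ((7 : ℕ) : ℤ) ∣ 432 * (-54 * B) ^ 2 * ((7 : ℕ) : ℤ) ^ t₆ := Dvd.dvd.mul_left (dvd_pow_self _ ht6) _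
      have hY : ¬ ((7 : ℕ) : ℤ) ∣ 64 * (-27 * A) ^ 3 := by
        intro hY; apply hU; rw [ht4, pow_zero, mul_one]; exact dvd_add hY hX
      refine ⟨?_, ?_⟩
      · have hΔE : E₀.Δ = -(64 * (-27 * A) ^ 3) := by
          rw [hE₀]
          simp only [if_pos hr4, if_neg hr6, ha, WeierstrassCurve.Δ, WeierstrassCurve.b₂, WeierstrassCurve.b₄, WeierstrassCurve.b₆,
            WeierstrassCurve.b₈]
          ring
        rw [hΔE, dvd_neg]; exact hY
      · rw [hmap, hasseCoeff_seven_short, if_neg hr6, Int.cast_zero, mul_zero]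
  obtain ⟨hΔ₀, hA₀⟩ := hE₀Δ
  have hE₀Δ0 : E₀.Δ ≠ 0 := fun h => hΔ₀ (h ▸ dvd_zero _)
  haveI : (E₀.map (Int.castRingHom ℚ_[p])).IsElliptic :=
    ⟨by rw [WeierstrassCurve.map_Δ, isUnit_iff_ne_zero, eq_intCast]; exact Int.cast_ne_zero.mpr hE₀Δ0⟩
  haveI : (E₀.map (Int.castRingHom (ZMod p))).IsElliptic :=
    ⟨by rw [WeierstrassCurve.map_Δ, isUnit_iff_ne_zero, eq_intCast, Ne, ZMod.intCast_zmod_eq_zero_iff_dvd]; exact_mod_cast hΔ₀⟩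
  haveI : (curveOver (CompletedAlgClosure (v'.adicCompletion K)) E₀).IsElliptic := AinfTop.isElliptic_curveOverC E₀ hE₀Δ0
  -- §5 (N1′) at a Tate-module witness, and `N = e`
  have hθ : Function.Surjective (WittVector.fontaineTheta (integerC (v'.adicCompletion K)) p) := surjective_fontaineTheta_integerC hp'
  obtain ⟨τ, hτ1, -⟩ :=
    AinfTop.exists_tatePtO_norm_p_lt_norm_pow_model hD (ψ₀.comp (EisensteinRoot.CoeffDisc.of D).toRingHom) ((-27 * A : ℤ) : ℤ_[p])
      ((-54 * B : ℤ) : ℤ_[p]) hp57 h₄ h₆ hunit' hr₄ hr₆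
  have hN1seq : ∀ {t : ℕ → (maxNilIdealC (v'.adicCompletion K)).toIdeal} (ht0 : (t 0 : CBall (v'.adicCompletion K)) = 0)
      (htp : ∀ n, AinfRamTop.mulPC Wm (t (n + 1)) = t n),
      (t 1 : CBall (v'.adicCompletion K)) ≠ 0 → AinfRamTop.omegaPeriod Wm hθ t ht0 htp ≠ 0 := by
    intro t ht0 htp h1
    rcases hp57 with rfl | rfl
    · obtain ⟨hr, he', her⟩ := h5 rfl
      exact AinfRamTop.omegaPeriod_model_five_ne_zero_of_lt hD _ _ hr he' her h₄ h₆ hunit' ht0 htp h1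
    · obtain ⟨hr, he', her⟩ := h7 rfl
      exact AinfRamTop.omegaPeriod_model_seven_ne_zero_of_lt hD _ _ hr he' her h₄ h₆ hunit' ht0 htp h1
  have hN1 := AinfRamTop.exists_omegaPeriodHomO_ne_zero Wm ψ₀ (hθ := hθ) (hψ := hψ₀) hN1seq ⟨τ, hτ1⟩
  have hNe : D.e ≤ e := (D.e_eq_of_poly_eq hD).le
  -- §6 the socket data for `W` over `F`: `|u| ≤ 1`, the `ℤ_p`-valued `log χ`, `heL/healt/henondeg` from `halt`, integrality of the model
  have hp1ω : ω' ((p : ℕ) : (v'.adicCompletion K)) < 1 := (ValuativeRel.isEquiv ω' (valuation (v'.adicCompletion K))).lt_one_iff_lt_one.mpr hp'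
  have hϖω : ω' ϖ ≤ 1 := by
    have hlt : ω' ϖ ^ e < 1 := by rw [← map_pow, hϖe]; exact_mod_cast hp1ω
    exact le_of_not_gt fun h => absurd hlt (not_lt.2 (one_le_pow₀ h.le))
  have h6ω : ω' (6 : (v'.adicCompletion K)) = 1 := by
    have h6le : ω' (6 : (v'.adicCompletion K)) ≤ 1 := by exact_mod_cast FormalGroupChart.val_natCast_le_one ω' 6
    refine le_antisymm h6le (le_of_not_gt fun hlt => ?_)
    -- Bézout at `p ∈ {5, 7}`: `1 = 6·a + p·b` with `a, b ∈ ℤ`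
    obtain ⟨a, b, hab⟩ : ∃ a b : ℤ, (1 : (v'.adicCompletion K)) = 6 * (a : (v'.adicCompletion K)) + ((p : ℕ) : (v'.adicCompletion K)) * (b : (v'.adicCompletion K)) := by
      rcases hp57 with rfl | rfl
      · exact ⟨1, -1, by push_cast; ring⟩
      · exact ⟨-1, 1, by push_cast; ring⟩
    have h1 : ω' (1 : (v'.adicCompletion K)) < 1 := by
      rw [hab]
      refine lt_of_le_of_lt (ω'.map_add _ _) (max_lt ?_ ?_)
      · rw [map_mul]; exact mul_lt_one_of_nonneg_of_lt_one_left (by positivity) hlt (Literature.NumberTheory.EllipticCurves.val_intCast_le_one ω' a)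
      · rw [map_mul]; exact mul_lt_one_of_nonneg_of_lt_one_left (by positivity) hp1ω (Literature.NumberTheory.EllipticCurves.val_intCast_le_one ω' b)
    exact absurd h1 (by rw [map_one]; exact lt_irrefl 1)
  have hu : ω' ((C.map (algebraMap K (v'.adicCompletion K))).u : (v'.adicCompletion K)) ≤ 1 := by
    have hCu' : (((C.map (algebraMap K (v'.adicCompletion K))).u : (v'.adicCompletion K))) = ϖ ^ k / 6 := by
      change algebraMap K (v'.adicCompletion K) (C.u : K) = _
      rw [hCu, map_div₀, map_pow, ← hϖ, map_ofNat]
    rw [hCu', map_div₀, h6ω, div_one, map_pow]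
    exact pow_le_one₀ (by positivity) hϖω
  obtain ⟨ψ, hψ, hψlog⟩ := exists_continuousMap_coe_eq_logCyclotomic (v'.adicCompletion K) p
  have heL := weilContPairingPadic_toLin_smul_left (F := (v'.adicCompletion K)) W eT hμ hadd₁ hadd₂ hgal hcompat halt
  have healt := weilContPairingPadic_toLin_self (F := (v'.adicCompletion K)) W eT hμ hadd₁ hadd₂ hgal hcompat halt
  have henondeg := weilContPairingPadic_toLin_nondegenerate (F := (v'.adicCompletion K)) W eT hμ hadd₁ hadd₂ hgal hcompat halt hnondeg
  haveI : (AinfTop.curveFO (v'.adicCompletion K) (Wm.map ψ₀)).IsIntegral ω'.integer := AinfTop.isIntegral_curveFO _ ω'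
  -- §7 E6
  exact TransportedReciprocityOfVariableChange.exists_const_tatePairingPoint_eq_trace_mul_padicLog_of_variableChange v' hp' D Wm ψ₀ hψ₀ hp2 hΔ hHasse
    W eT hμ hadd₁ hadd₂ hgal hcompat hp5 E₀ hWE hΔ₀ hA₀ hNe hN1 ψ hψ hψlog heL healt henondeg hinjK (fun η => hdeK (pushRational p η)) d'' ω'
    (C.map (algebraMap K (v'.adicCompletion K))) hCE hu

end Summit.BirchSwinnertonDyer.BirchSwinnertonDyer.Theorems.StarredOptimalManinUnitFiveSevenLocalFormulaSupersingularCellsNumerology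

end
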